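import Literature.Computability.QuantumComplexity.LightConeAmp
import Literature.Computability.QuantumComplexity.ZOmegaCodesFP
import Literature.Computability.Complexity.BrickAlgebra
import HarnessLib

/-!
# The light-cone simulator as an `FP` machine, I: codes of `ℤ[ω]`-coordinates and their arithmetic

First file of the machine half of the discharge of
`Literature.Barriers.QuantumAdvantage.markovShi2008_cor15_anyOrder` (Markov–Shi 2008, Cor. 1.5, decision form):
the functional simulator of `LightConeSim.lean`/`LightConeSimInit.lean`/`LightConeDecision.lean` is
realised in the brick algebra of `FP` string functions (`BrickAlgebra.lean`, `ZIntBricks.lean`,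
`ListFoldBricks.lean`), in the manner of `ADHMachine.lean`. Here: the code
`ampEnc a = ⟨dpEnc c₀, ⟨dpEnc c₁, ⟨dpEnc c₂, dpEnc c₃⟩⟩⟩` of a coordinate quadruple (`LightCone.Amp`)
by canonical difference-pair numerals — the four-field records `ZWCode.rec4`/`ZWCode.mk4` and the
size lemma `ZWCode.length_dpEnc_le_of_lt` of `ZOmegaCodesFP.lean` (the parallel code layer for the
function-table simulator `StateVectorDP.lean`, same layout over `ZW = Fin 4 → ℤ`) are reused; the
arithmetic bricks below are the ones the association-list machine of `LightConeMachine*.lean`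
composes (values stated on `ampEnc` of the `Amp` structure of `LightConeAmp.lean`) — and the bricks

* `negAmpF`, `mulOmegaF` (on one code; unlike `ZWCode.mulOmegaF` the copied fields are not
  re-canonicalised — on codes the two agree), `addAmpF` (on a pair of codes; the `ZWCode.zwAddF`
  pattern), `normAF`, `normBF` (the integers `A(a)`, `B(a)` of `|Σ cₖ ωᵏ|² = A + B√2`; cf.
  `ZWCode.zwUF`/`zwVF`), the constants `zeroAmpC`, `oneAmpC`;
* for each: the value on codes (`…_ampEnc`), membership in `FP`, and a total output-length bound
  (linear in the input length, valid on every string — the shape the fold combinators need);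
* `length_ampEnc_le_of_lt`: a code whose coordinates are `< 2^t` in absolute value has at most
  `14 t + 20` symbols (the size bookkeeping of the simulation; `ZWCode.length_enc_le` for tables).

## References

* S. Arora, B. Barak, *Computational Complexity: A Modern Approach*, CUP 2009, §1.3 (polynomial
  time is closed under composition).
* D. E. Knuth, *The Art of Computer Programming*, Vol. 2, §4.3.1 (multiple-precision arithmetic).
-/

noncomputable section

namespace Literature.Computability.QuantumComplexity

open _root_.Computability Complexity Complexity.Brick

namespace LightCone

attribute [-simp] Brick.nthF_zero Brick.sndPow_zero

/-! ### Plumbing -/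

/-- Pairing two field functions (`fanoutFn`). [folklore] -/
abbrev pr (f g : List Bool → List Bool) : List Bool → List Bool := fanoutFn f g

/-- `pr` applied. [folklore] -/
@[simp] theorem pr_apply (f g : List Bool → List Bool) (z : List Bool) : pr f g z = boolPair (f z) (g z) :=
  fanoutFn_apply f g z

/-- Field `0` of a record. [folklore] -/
abbrev q0F : List Bool → List Bool := nthF 0
/-- Field `1` of a record. [folklore] -/
abbrev q1F : List Bool → List Bool := nthF 1
/-- Field `2` of a record. [folklore] -/
abbrev q2F : List Bool → List Bool := nthF 2
/-- Field `3` (the tail after field `2`) of a record. [folklore] -/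
abbrev q3F : List Bool → List Bool := sndPow 2

/-- The four fields together are not longer than the record: `2(|q0| + |q1| + |q2|) + |q3| ≤ |z|`.
[folklore] -/
theorem length_fields4_le (z : List Bool) :
    2 * ((q0F z).length + (q1F z).length + (q2F z).length) + (q3F z).length ≤ z.length := by
  have h0 : 2 * (nthF 0 z).length + (sndPow 0 z).length ≤ z.length := by
    simpa [Brick.nthF_zero, Brick.sndPow_zero] using length_fstF_sndF_le z
  have h1 : 2 * (nthF 1 z).length + (sndPow 1 z).length ≤ (sndPow 0 z).length :=
    length_nthF_succ_add_sndPow_succ_le 0 z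
  have h2 : 2 * (nthF 2 z).length + (sndPow 2 z).length ≤ (sndPow 1 z).length :=
    length_nthF_succ_add_sndPow_succ_le 1 z
  show 2 * ((nthF 0 z).length + (nthF 1 z).length + (nthF 2 z).length) + (sndPow 2 z).length ≤ z.length
  omega

/-! ### Codes of coordinate quadruples -/

/-- **The code of a coordinate quadruple**: the record of the four canonical integer codes.
[folklore] -/
def ampEnc (a : Amp) : List Bool := ZWCode.rec4 (dpEnc a.c0) (dpEnc a.c1) (dpEnc a.c2) (dpEnc a.c3)

/-- The code of `0`. [folklore] -/
def zeroAmpC : List Bool := ampEnc 0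

/-- The code of `1`. [folklore] -/
def oneAmpC : List Bool := ampEnc 1

/-- The fields of a code. [folklore] -/
theorem fields_ampEnc (a : Amp) :
    q0F (ampEnc a) = dpEnc a.c0 ∧ q1F (ampEnc a) = dpEnc a.c1 ∧ q2F (ampEnc a) = dpEnc a.c2 ∧
      q3F (ampEnc a) = dpEnc a.c3 :=
  ZWCode.fields_rec4 _ _ _ _

/-- `ampEnc` is injective (canonical codes are). [folklore] -/
theorem ampEnc_injective : Function.Injective ampEnc := by
  intro a b h
  obtain ⟨h0, h1, h2, h3⟩ := fields_ampEnc a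
  obtain ⟨k0, k1, k2, k3⟩ := fields_ampEnc b
  rw [h] at h0 h1 h2 h3
  have e0 := dpEnc_injective (h0.symm.trans k0)
  have e1 := dpEnc_injective (h1.symm.trans k1)
  have e2 := dpEnc_injective (h2.symm.trans k2)
  have e3 := dpEnc_injective (h3.symm.trans k3)
  cases a; cases b; simp_all

/-- **Size of a code with small coordinates**: `|ampEnc a| ≤ 14 t + 20` when all `|cₖ| < 2^t`.
[folklore] -/
theorem length_ampEnc_le_of_lt {a : Amp} {t : ℕ} (h0 : a.c0.natAbs < 2 ^ t) (h1 : a.c1.natAbs < 2 ^ t)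
    (h2 : a.c2.natAbs < 2 ^ t) (h3 : a.c3.natAbs < 2 ^ t) : (ampEnc a).length ≤ 14 * t + 20 := by
  rw [ampEnc, ZWCode.length_rec4]
  have := ZWCode.length_dpEnc_le_of_lt h0
  have := ZWCode.length_dpEnc_le_of_lt h1
  have := ZWCode.length_dpEnc_le_of_lt h2
  have := ZWCode.length_dpEnc_le_of_lt h3
  omega

/-- The constant codes are short: `|ampEnc 0| = 20`. [folklore] -/
theorem length_zeroAmpC : zeroAmpC.length = 20 := by
  have h0 : encodeNat 0 = [] := by decide
  simp [zeroAmpC, ampEnc, ZWCode.rec4, Amp.zero_def, dpEnc, length_boolPair, h0]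

/-- `|ampEnc 1| = 24`. [folklore] -/
theorem length_oneAmpC : oneAmpC.length = 24 := by
  have h0 : encodeNat 0 = [] := by decide
  have h : encodeNat 1 = [true] := by decide
  simp [oneAmpC, ampEnc, ZWCode.rec4, Amp.one_def, dpEnc, length_boolPair, h, h0]

/-! ### Negation and multiplication by `ω` -/

/-- The length of a canonical code in terms of the length of any code of the same value:
`|dpEnc (± ival w)| ≤ 2|w| + 2`. [folklore] -/
theorem length_dpEnc_neg_ival_le (w : List Bool) : (dpEnc (-ival w)).length ≤ 2 * w.length + 2 := by
  have h := length_dpEnc_le_two_mul (-ival w)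
  rw [Int.natAbs_neg] at h
  have h2 := length_encodeNat_natAbs_ival_le w
  have h3 := zlen_le_length w
  omega

/-- **Negation** of a code, coordinatewise. [folklore] -/
def negAmpF : List Bool → List Bool := ZWCode.mk4 (znegF ∘ q0F) (znegF ∘ q1F) (znegF ∘ q2F) (znegF ∘ q3F)

/-- `negAmpF (ampEnc a) = ampEnc (-a)`. [folklore] -/
@[simp] theorem negAmpF_ampEnc (a : Amp) : negAmpF (ampEnc a) = ampEnc (-a) := by
  obtain ⟨h0, h1, h2, h3⟩ := fields_ampEnc a
  simp only [negAmpF, ZWCode.mk4_apply, Function.comp_apply, h0, h1, h2, h3, znegF_eq, ival_dpEnc]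
  rfl

/-- `negAmpF ∈ FP`. [folklore] -/
theorem negAmpF_mem_FP : negAmpF ∈ FP :=
  ZWCode.mk4_mem_FP (comp_mem_FP znegF_mem_FP (nthF_mem_FP 0)) (comp_mem_FP znegF_mem_FP (nthF_mem_FP 1))
    (comp_mem_FP znegF_mem_FP (nthF_mem_FP 2)) (comp_mem_FP znegF_mem_FP (sndPow_mem_FP 2))

/-- Total growth of `negAmpF`: `|negAmpF w| ≤ 2|w| + 20` on every string. [folklore] -/
theorem length_negAmpF_le (w : List Bool) : (negAmpF w).length ≤ 2 * w.length + 20 := by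
  rw [negAmpF, ZWCode.mk4_apply, ZWCode.length_rec4]
  simp only [Function.comp_apply, znegF_eq]
  have hf := length_fields4_le w
  have e0 := length_dpEnc_neg_ival_le (q0F w)
  have e1 := length_dpEnc_neg_ival_le (q1F w)
  have e2 := length_dpEnc_neg_ival_le (q2F w)
  have e3 := length_dpEnc_neg_ival_le (q3F w)
  omega

/-- **Multiplication by `ω`** on codes: `⟨c₀, c₁, c₂, c₃⟩ ↦ ⟨-c₃, c₀, c₁, c₂⟩`. [folklore] -/
def mulOmegaF : List Bool → List Bool := ZWCode.mk4 (znegF ∘ q3F) q0F q1F q2F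

/-- `mulOmegaF (ampEnc a) = ampEnc a.mulOmega`. [folklore] -/
@[simp] theorem mulOmegaF_ampEnc (a : Amp) : mulOmegaF (ampEnc a) = ampEnc a.mulOmega := by
  obtain ⟨h0, h1, h2, h3⟩ := fields_ampEnc a
  simp only [mulOmegaF, ZWCode.mk4_apply, Function.comp_apply, h0, h1, h2, h3, znegF_eq, ival_dpEnc]
  rfl

/-- `mulOmegaF ∈ FP`. [folklore] -/
theorem mulOmegaF_mem_FP : mulOmegaF ∈ FP :=
  ZWCode.mk4_mem_FP (comp_mem_FP znegF_mem_FP (sndPow_mem_FP 2)) (nthF_mem_FP 0) (nthF_mem_FP 1) (nthF_mem_FP 2)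

/-- Total growth of `mulOmegaF`: `|mulOmegaF w| ≤ 4|w| + 10` on every string. [folklore] -/
theorem length_mulOmegaF_le (w : List Bool) : (mulOmegaF w).length ≤ 4 * w.length + 10 := by
  rw [mulOmegaF, ZWCode.mk4_apply, ZWCode.length_rec4]
  simp only [Function.comp_apply, znegF_eq]
  have hf := length_fields4_le w
  have e3 := length_dpEnc_neg_ival_le (q3F w)
  omega

/-! ### Addition -/

/-- `|zaddF ⟨a, b⟩| ≤ 2(|a| + |b|) + 4`. [folklore] -/
theorem length_zaddF_le' (a b : List Bool) : (zaddF (boolPair a b)).length ≤ 2 * (a.length + b.length) + 4 := by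
  have h := length_zaddF_le a b
  have ha := zlen_le_length a
  have hb := zlen_le_length b
  have : max (zlen a) (zlen b) ≤ a.length + b.length := by
    rcases le_total (zlen a) (zlen b) with hab | hab
    · rw [max_eq_right hab]; omega
    · rw [max_eq_left hab]; omega
  omega

/-- `|zsubF ⟨a, b⟩| ≤ 2(|a| + |b|) + 4`. [folklore] -/
theorem length_zsubF_le' (a b : List Bool) : (zsubF (boolPair a b)).length ≤ 2 * (a.length + b.length) + 4 := by
  have h := length_zsubF_le a b
  have ha := zlen_le_length a
  have hb := zlen_le_length b
  have : max (zlen a) (zlen b) ≤ a.length + b.length := by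
    rcases le_total (zlen a) (zlen b) with hab | hab
    · rw [max_eq_right hab]; omega
    · rw [max_eq_left hab]; omega
  omega

/-- `|zmulF ⟨a, b⟩| ≤ 2(|a| + |b|) + 2`. [folklore] -/
theorem length_zmulF_le' (a b : List Bool) : (zmulF (boolPair a b)).length ≤ 2 * (a.length + b.length) + 2 := by
  have h := length_zmulF_le a b
  have ha := zlen_le_length a
  have hb := zlen_le_length b
  omega

/-- The coordinatewise sum of field `f` of the two halves of a pair of codes. [folklore] -/
def addCoordF (f : List Bool → List Bool) : List Bool → List Bool := zaddF ∘ pr (f ∘ fstF) (f ∘ sndF)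

/-- **Addition** of a pair of codes `⟨ampEnc a, ampEnc b⟩`, coordinatewise. [folklore] -/
def addAmpF : List Bool → List Bool := ZWCode.mk4 (addCoordF q0F) (addCoordF q1F) (addCoordF q2F) (addCoordF q3F)

/-- `addAmpF ⟨ampEnc a, ampEnc b⟩ = ampEnc (a + b)`. [folklore] -/
@[simp] theorem addAmpF_boolPair (a b : Amp) : addAmpF (boolPair (ampEnc a) (ampEnc b)) = ampEnc (a + b) := by
  obtain ⟨h0, h1, h2, h3⟩ := fields_ampEnc a
  obtain ⟨k0, k1, k2, k3⟩ := fields_ampEnc b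
  simp only [addAmpF, addCoordF, ZWCode.mk4_apply, Function.comp_apply, fanoutFn_apply, fstF_boolPair, sndF_boolPair,
    h0, h1, h2, h3, k0, k1, k2, k3, zaddF_boolPair, ival_dpEnc]
  rfl

/-- `addAmpF ∈ FP`. [folklore] -/
theorem addAmpF_mem_FP : addAmpF ∈ FP := by
  have h : ∀ {f : List Bool → List Bool}, f ∈ FP → addCoordF f ∈ FP := fun hf =>
    comp_mem_FP zaddF_mem_FP (fanoutFn_mem_FP (comp_mem_FP hf fstF_mem_FP) (comp_mem_FP hf sndF_mem_FP))
  exact ZWCode.mk4_mem_FP (h (nthF_mem_FP 0)) (h (nthF_mem_FP 1)) (h (nthF_mem_FP 2)) (h (sndPow_mem_FP 2))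

/-- Total growth of `addAmpF`: `|addAmpF ⟨p, q⟩| ≤ 4(|p| + |q|) + 34` on every pair. [folklore] -/
theorem length_addAmpF_le (p q : List Bool) : (addAmpF (boolPair p q)).length ≤ 4 * (p.length + q.length) + 34 := by
  rw [addAmpF, ZWCode.mk4_apply, ZWCode.length_rec4]
  simp only [addCoordF, Function.comp_apply, fanoutFn_apply, fstF_boolPair, sndF_boolPair]
  have hp := length_fields4_le p
  have hq := length_fields4_le q
  have e0 := length_zaddF_le' (q0F p) (q0F q)
  have e1 := length_zaddF_le' (q1F p) (q1F q)
  have e2 := length_zaddF_le' (q2F p) (q2F q)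
  have e3 := length_zaddF_le' (q3F p) (q3F q)
  omega

/-! ### The norm integers `A` and `B` -/

/-- The product of two coordinate fields of a code. [folklore] -/
def mulCoordF (f g : List Bool → List Bool) : List Bool → List Bool := zmulF ∘ pr f g

/-- **`A(a) = Σ cₖ²`** on codes. [folklore] -/
def normAF : List Bool → List Bool :=
  zaddF ∘ pr (zaddF ∘ pr (mulCoordF q0F q0F) (mulCoordF q1F q1F)) (zaddF ∘ pr (mulCoordF q2F q2F) (mulCoordF q3F q3F))

/-- **`B(a) = c₀c₁ + c₁c₂ + c₂c₃ − c₀c₃`** on codes. [folklore] -/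
def normBF : List Bool → List Bool :=
  zsubF ∘ pr (zaddF ∘ pr (zaddF ∘ pr (mulCoordF q0F q1F) (mulCoordF q1F q2F)) (mulCoordF q2F q3F)) (mulCoordF q0F q3F)

/-- `normAF (ampEnc a) = dpEnc (normA a)`. [folklore] -/
@[simp] theorem normAF_ampEnc (a : Amp) : normAF (ampEnc a) = dpEnc a.normA := by
  obtain ⟨h0, h1, h2, h3⟩ := fields_ampEnc a
  have key : a.normA = a.c0 * a.c0 + a.c1 * a.c1 + (a.c2 * a.c2 + a.c3 * a.c3) := by
    simp only [Amp.normA]; ring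
  rw [key]
  simp only [normAF, mulCoordF, Function.comp_apply, fanoutFn_apply, h0, h1, h2, h3, zmulF_boolPair, zaddF_boolPair,
    ival_dpEnc]

/-- `normBF (ampEnc a) = dpEnc (normB a)`. [folklore] -/
@[simp] theorem normBF_ampEnc (a : Amp) : normBF (ampEnc a) = dpEnc a.normB := by
  obtain ⟨h0, h1, h2, h3⟩ := fields_ampEnc a
  simp only [normBF, mulCoordF, Function.comp_apply, fanoutFn_apply, h0, h1, h2, h3, zmulF_boolPair, zaddF_boolPair,
    zsubF_boolPair, ival_dpEnc, Amp.normB]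

/-- `normAF ∈ FP`. [folklore] -/
theorem normAF_mem_FP : normAF ∈ FP := by
  have hm : ∀ {f g : List Bool → List Bool}, f ∈ FP → g ∈ FP → mulCoordF f g ∈ FP := fun hf hg =>
    comp_mem_FP zmulF_mem_FP (fanoutFn_mem_FP hf hg)
  exact comp_mem_FP zaddF_mem_FP (fanoutFn_mem_FP
    (comp_mem_FP zaddF_mem_FP (fanoutFn_mem_FP (hm (nthF_mem_FP 0) (nthF_mem_FP 0)) (hm (nthF_mem_FP 1) (nthF_mem_FP 1))))
    (comp_mem_FP zaddF_mem_FP (fanoutFn_mem_FP (hm (nthF_mem_FP 2) (nthF_mem_FP 2)) (hm (sndPow_mem_FP 2) (sndPow_mem_FP 2)))))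

/-- `normBF ∈ FP`. [folklore] -/
theorem normBF_mem_FP : normBF ∈ FP := by
  have hm : ∀ {f g : List Bool → List Bool}, f ∈ FP → g ∈ FP → mulCoordF f g ∈ FP := fun hf hg =>
    comp_mem_FP zmulF_mem_FP (fanoutFn_mem_FP hf hg)
  exact comp_mem_FP zsubF_mem_FP (fanoutFn_mem_FP
    (comp_mem_FP zaddF_mem_FP (fanoutFn_mem_FP
      (comp_mem_FP zaddF_mem_FP (fanoutFn_mem_FP (hm (nthF_mem_FP 0) (nthF_mem_FP 1)) (hm (nthF_mem_FP 1) (nthF_mem_FP 2))))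
      (hm (nthF_mem_FP 2) (sndPow_mem_FP 2))))
    (hm (nthF_mem_FP 0) (sndPow_mem_FP 2)))

/-- Total growth of `normAF`: `|normAF w| ≤ 16|w| + 72` on every string. [folklore] -/
theorem length_normAF_le (w : List Bool) : (normAF w).length ≤ 16 * w.length + 72 := by
  have hf := length_fields4_le w
  simp only [normAF, mulCoordF, Function.comp_apply, fanoutFn_apply]
  have m0 := length_zmulF_le' (q0F w) (q0F w)
  have m1 := length_zmulF_le' (q1F w) (q1F w)
  have m2 := length_zmulF_le' (q2F w) (q2F w)
  have m3 := length_zmulF_le' (q3F w) (q3F w)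
  have a1 := length_zaddF_le' (zmulF (boolPair (q0F w) (q0F w))) (zmulF (boolPair (q1F w) (q1F w)))
  have a2 := length_zaddF_le' (zmulF (boolPair (q2F w) (q2F w))) (zmulF (boolPair (q3F w) (q3F w)))
  have a3 := length_zaddF_le' (zaddF (boolPair (zmulF (boolPair (q0F w) (q0F w))) (zmulF (boolPair (q1F w) (q1F w)))))
    (zaddF (boolPair (zmulF (boolPair (q2F w) (q2F w))) (zmulF (boolPair (q3F w) (q3F w)))))
  omega

/-- Total growth of `normBF`: `|normBF w| ≤ 16|w| + 72` on every string. [folklore] -/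
theorem length_normBF_le (w : List Bool) : (normBF w).length ≤ 16 * w.length + 72 := by
  have hf := length_fields4_le w
  simp only [normBF, mulCoordF, Function.comp_apply, fanoutFn_apply]
  have m0 := length_zmulF_le' (q0F w) (q1F w)
  have m1 := length_zmulF_le' (q1F w) (q2F w)
  have m2 := length_zmulF_le' (q2F w) (q3F w)
  have m3 := length_zmulF_le' (q0F w) (q3F w)
  have a1 := length_zaddF_le' (zmulF (boolPair (q0F w) (q1F w))) (zmulF (boolPair (q1F w) (q2F w)))
  have a2 := length_zaddF_le' (zaddF (boolPair (zmulF (boolPair (q0F w) (q1F w))) (zmulF (boolPair (q1F w) (q2F w)))))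
    (zmulF (boolPair (q2F w) (q3F w)))
  have a3 := length_zsubF_le' (zaddF (boolPair (zaddF (boolPair (zmulF (boolPair (q0F w) (q1F w)))
    (zmulF (boolPair (q1F w) (q2F w))))) (zmulF (boolPair (q2F w) (q3F w))))) (zmulF (boolPair (q0F w) (q3F w)))
  omega

end LightCone

end Literature.Computability.QuantumComplexity

end
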